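import Summits.AtomisticToContinuum.FouriersLaw.Theorems.JunctionLocalityNonBallisticLightConeMomentumTail
import Summits.AtomisticToContinuum.FouriersLaw.Theorems.PhononMeanFreePathIncoherentChannelLightConeHelper6
import Mathlib.Analysis.PSeries

/-!
# `N`-uniform one-site tails under the stationary law of the open pinned chain (light cone of (C′), statics)

Helper (`--supports stmt-AtomisticToContinuum-14013`) for the line `series-law-at-every-laplace-frequency`
(SketchIdeator2) of the crux `LatticeLandauDamping.AbelThermodynamicLimit`, stub (C′)
`stub_uniformAnchoredCorrelationTails`. Registered sub-goal `pinnedChain_stationary_site_tails`.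

Probabilistic input of the `N`-UNIFORM light cone of the open chain (companion of the pathwise weighted
propagation bound `chainFlow_momentumFlip_propagation_weighted`). Under the stationary law `π = μ_T ⊗ W` (Gibbs
start, independent Brownian pair) of the constructed Langevin flow `Φ_r(x, Bω) = solMap N T T r x (pairPath ω)`:

* `position_tail` — `π{θ < q_j(0)²} ≤ C/θ^{16}` (Markov with the 32nd Gibbs position moment, dominated at EVERY
  site by the one-site Gibbs state, `lightCone_gibbs_position_moments`);
* `timeIntegral_tail` — `π{θ < ∫₀ᵗ p_j(Φ_r)² dr} ≤ C t^{16}/θ^{16}` (Jensen in time with the sixteenth power,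
  Tonelli, stationarity of the kernel process from the Gibbs start, Gaussian momenta of order 32);
* `pinnedChain_stationary_site_tails` (registered) — both, with ONE constant independent of `N` and of the site.

With the weight `g(n) = √(1+n)` of the weighted box `q_{j'}² ≤ ρ² g(|j - i₀|)` these tails are summable over the
sites UNIFORMLY in `N`: `Σ_j g(|j - i₀|)^{-16} ≤ Σ_j (1 + |j - i₀|)^{-2} ≤ 4` (`sum_inv_sq_dist_le`); the weight is
admissible for the abstract Dobrushin–Fritz iteration (`weight_one_le`, `weight_monotone`, `weight_le`,
`weight_antitone`). Folklore; no definitions.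
-/

noncomputable section

open MeasureTheory ProbabilityTheory Set Filter Topology Finset
open scoped NNReal ENNReal BigOperators

namespace Summit.AtomisticToContinuum.FouriersLaw.Theorems.AbelThermodynamicLimit.SeriesLawAtEveryLaplaceFrequency

open Literature.MathematicalPhysics.KineticTheory Literature.MathematicalPhysics.KineticTheory.HeatConduction
open Literature.Probability.Process OscillatorChain
open Summit.AtomisticToContinuum.FouriersLaw.Theorems.NonBallistic
open Summit.AtomisticToContinuum.FouriersLaw.Theorems.PhononMeanFreePath
  (lightCone_gibbs_position_moments lightCone_pow_intervalIntegral_le commonPastBound_gibbsEvenMoments)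

namespace BoxTail

/-! ### The weight `g(n) = √(1 + n)` is admissible -/

/-- `1 ≤ √(1+n)`. [folklore] -/
theorem weight_one_le (n : ℕ) : 1 ≤ Real.sqrt (1 + (n : ℝ)) := by
  rw [show (1 : ℝ) = Real.sqrt 1 by rw [Real.sqrt_one]]
  exact Real.sqrt_le_sqrt (by have : (0 : ℝ) ≤ n := n.cast_nonneg; rw [Real.sqrt_one]; linarith)

/-- `n ↦ √(1+n)` is monotone. [folklore] -/
theorem weight_monotone : Monotone fun n : ℕ => Real.sqrt (1 + (n : ℝ)) :=
  fun _ _ h => Real.sqrt_le_sqrt (by exact_mod_cast Nat.add_le_add_left h 1)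

/-- `√(1+n) ≤ 3 + n`. [folklore] -/
theorem weight_le (n : ℕ) : Real.sqrt (1 + (n : ℝ)) ≤ 3 + n := by
  have hn : (0 : ℝ) ≤ n := n.cast_nonneg
  rw [Real.sqrt_le_left (by linarith)]
  nlinarith

/-- Antitonicity of `g(2m)/m`: `m √(1 + 2m') ≤ m' √(1 + 2m)` for `1 ≤ m ≤ m'`. [folklore] -/
theorem weight_antitone (m m' : ℕ) (hm : 1 ≤ m) (hmm' : m ≤ m') :
    (m : ℝ) * Real.sqrt (1 + ((2 * m' : ℕ) : ℝ)) ≤ m' * Real.sqrt (1 + ((2 * m : ℕ) : ℝ)) := by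
  have hm0 : (1 : ℝ) ≤ m := by exact_mod_cast hm
  have hmm : (m : ℝ) ≤ m' := by exact_mod_cast hmm'
  have hmn : (0 : ℝ) ≤ m := by linarith
  have hm'n : (0 : ℝ) ≤ m' := by linarith
  push_cast
  have e1 : (m : ℝ) * Real.sqrt (1 + 2 * (m' : ℝ)) = Real.sqrt ((m : ℝ) ^ 2 * (1 + 2 * (m' : ℝ))) := by
    rw [Real.sqrt_mul (sq_nonneg _), Real.sqrt_sq hmn]
  have e2 : (m' : ℝ) * Real.sqrt (1 + 2 * (m : ℝ)) = Real.sqrt ((m' : ℝ) ^ 2 * (1 + 2 * (m : ℝ))) := by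
    rw [Real.sqrt_mul (sq_nonneg _), Real.sqrt_sq hm'n]
  rw [e1, e2]
  refine Real.sqrt_le_sqrt ?_
  nlinarith [mul_nonneg (mul_nonneg hmn hm'n) (sub_nonneg.2 hmm), mul_nonneg (by linarith : (0 : ℝ) ≤ m' + m)
    (sub_nonneg.2 hmm)]

/-- `√(1+n)^{16} = (1+n)^8`. [folklore] -/
theorem weight_pow_sixteen (n : ℕ) : Real.sqrt (1 + (n : ℝ)) ^ 16 = (1 + (n : ℝ)) ^ 8 := by
  rw [show (16 : ℕ) = 2 * 8 by norm_num, pow_mul, Real.sq_sqrt (by positivity)]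

/-! ### The lattice sum `Σ_j (1 + |j - i₀|)^{-2} ≤ 4`, uniformly in `N` -/

/-- **The lattice sum**: `Σ_{j : Fin N} (1 + |j - i₀|)^{-2} ≤ 4` for every `N` and every `i₀ : Fin N` (each
distance is attained at most twice, and `Σ_{n<N} 1/(n+1)² ≤ 2`, Mathlib's `sum_Ioo_inv_sq_le`; cf. the tree's
`QuantumLattice.sum_range_one_div_sq_le_two`). [folklore] -/
theorem sum_inv_sq_dist_le {N : ℕ} (i₀ : Fin N) :
    ∑ j : Fin N, 1 / (1 + ((((j : ℕ) : ℤ) - i₀).natAbs : ℝ)) ^ 2 ≤ 4 := by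
  set F : ℕ → ℝ := fun n => 1 / ((n : ℝ) + 1) ^ 2 with hF
  have sum_range_inv_succ_sq_le : ∀ N : ℕ, ∑ n ∈ range N, F n ≤ 2 := by
    intro N
    have h := sum_Ioo_inv_sq_le (α := ℝ) 0 (N + 1)
    rw [Nat.cast_zero, zero_add, div_one] at h
    have hI : Finset.Ioo 0 (N + 1) = Finset.Ico 1 (N + 1) := by
      ext i; simp only [Finset.mem_Ioo, Finset.mem_Ico]; omega
    rw [hI, Finset.sum_Ico_eq_sum_range, Nat.add_sub_cancel] at h
    refine le_trans (le_of_eq (Finset.sum_congr rfl fun n _ => ?_)) h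
    simp only [hF]
    push_cast
    rw [one_div, add_comm]
  have hF0 : ∀ n, 0 ≤ F n := fun n => by positivity
  have hsum : ∀ j : Fin N, 1 / (1 + ((((j : ℕ) : ℤ) - i₀).natAbs : ℝ)) ^ 2 = F ((((j : ℕ) : ℤ) - i₀).natAbs) := by
    intro j; simp only [hF]; ring
  simp_rw [hsum]
  rw [← Finset.sum_filter_add_sum_filter_not (s := Finset.univ) (p := fun j : Fin N => i₀ ≤ j)]
  have hR : ∑ j ∈ Finset.univ.filter (fun j : Fin N => i₀ ≤ j), F ((((j : ℕ) : ℤ) - i₀).natAbs) ≤ 2 := by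
    have hinj : Set.InjOn (fun j : Fin N => (((j : ℕ) : ℤ) - i₀).natAbs) ↑(Finset.univ.filter fun j : Fin N => i₀ ≤ j) := by
      intro a ha b hb hab
      simp only [Finset.coe_filter, Finset.mem_univ, true_and, Set.mem_setOf_eq] at ha hb
      have ha' : i₀.val ≤ a.val := ha
      have hb' : i₀.val ≤ b.val := hb
      exact Fin.ext (by simp only at hab; omega)
    rw [← Finset.sum_image hinj]
    refine le_trans (Finset.sum_le_sum_of_subset_of_nonneg ?_ fun n _ _ => hF0 n) (sum_range_inv_succ_sq_le N)
    intro n hn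
    simp only [Finset.mem_image, Finset.mem_filter, Finset.mem_univ, true_and] at hn
    obtain ⟨a, -, rfl⟩ := hn
    simp only [Finset.mem_range]
    have := a.isLt; omega
  have hL : ∑ j ∈ Finset.univ.filter (fun j : Fin N => ¬ i₀ ≤ j), F ((((j : ℕ) : ℤ) - i₀).natAbs) ≤ 2 := by
    have hinj : Set.InjOn (fun j : Fin N => (((j : ℕ) : ℤ) - i₀).natAbs)
        ↑(Finset.univ.filter fun j : Fin N => ¬ i₀ ≤ j) := by
      intro a ha b hb hab
      simp only [Finset.coe_filter, Finset.mem_univ, true_and, Set.mem_setOf_eq, not_le] at ha hb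
      have ha' : a.val < i₀.val := ha
      have hb' : b.val < i₀.val := hb
      exact Fin.ext (by simp only at hab; omega)
    rw [← Finset.sum_image hinj]
    refine le_trans (Finset.sum_le_sum_of_subset_of_nonneg ?_ fun n _ _ => hF0 n) (sum_range_inv_succ_sq_le N)
    intro n hn
    simp only [Finset.mem_image, Finset.mem_filter, Finset.mem_univ, true_and] at hn
    obtain ⟨a, -, rfl⟩ := hn
    simp only [Finset.mem_range]
    have := i₀.isLt; omega
  linarith

/-! ### `N`-uniform one-site tails under the stationary law `μ_T ⊗ W` -/

section Tails

variable {ω₂ lam β γ : ℝ} (hω : 0 < ω₂) (hl : 0 ≤ lam) (hβ : 0 ≤ β) (hγ : 0 ≤ γ) {T : ℝ} (hT : 0 < T)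

include hω hl hβ hT in
/-- **Position tail, `N`-uniform**: there is `C = C(ω₂, lam, β, T)` with
`(μ_T ⊗ W){θ < q_j(0)²} ≤ C/θ^{16}` for every `N`, every site `j` and every `θ > 0` (Markov with the 32nd Gibbs
position moment, dominated at every site by the one-site Gibbs state). [folklore] -/
theorem position_tail : ∃ C : ℝ, 0 ≤ C ∧ ∀ (N : ℕ) (j : Fin N) (θ : ℝ), 0 < θ →
    (((pinnedChain ω₂ lam β γ).gibbsMeasure N T).prod wienerPair)
        {q : PhaseSpace N × WienerPair | θ < q.1.1 j ^ 2} ≤ ENNReal.ofReal (C / θ ^ 16) := by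
  obtain ⟨C, hC⟩ := lightCone_gibbs_position_moments ω₂ lam β γ hω hl hβ T hT 16
  have hC0 : 0 ≤ C := by
    obtain ⟨h1, h2⟩ := hC 0 0
    exact le_trans (integral_nonneg fun z => (even_two_mul _).pow_nonneg _) h2
  refine ⟨C, hC0, fun N j θ hθ => ?_⟩
  obtain ⟨m, rfl⟩ : ∃ m, N = m + 1 := ⟨N - 1, by have := j.pos; omega⟩
  set μ := (pinnedChain ω₂ lam β γ).gibbsMeasure (m + 1) T with hμ
  haveI : IsProbabilityMeasure μ := pinnedChain_isProbabilityMeasure_gibbsMeasure hω hl hβ γ _ hT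
  obtain ⟨hint, hle⟩ := hC m j
  have hB : MeasurableSet {x : PhaseSpace (m + 1) | θ < x.1 j ^ 2} :=
    measurableSet_lt measurable_const (((measurable_pi_apply j).comp measurable_fst).pow_const 2)
  have h1 : (μ.prod wienerPair) {q : PhaseSpace (m + 1) × WienerPair | θ < q.1.1 j ^ 2} =
      μ {x | θ < x.1 j ^ 2} := by
    rw [show {q : PhaseSpace (m + 1) × WienerPair | θ < q.1.1 j ^ 2} = Prod.fst ⁻¹' {x | θ < x.1 j ^ 2} from rfl,
      ← Measure.map_apply measurable_fst hB, Measure.map_fst_prod, measure_univ, one_smul]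
  rw [h1]
  -- Markov with the 16th power of `q²`
  have hsub : {x : PhaseSpace (m + 1) | θ < x.1 j ^ 2} ⊆ {x | ENNReal.ofReal (θ ^ 16) ≤ ENNReal.ofReal (x.1 j ^ (2 * 16))} := by
    intro x hx
    simp only [Set.mem_setOf_eq] at hx ⊢
    refine ENNReal.ofReal_le_ofReal ?_
    rw [pow_mul]
    exact pow_le_pow_left₀ hθ.le hx.le 16
  have hθ16 : ENNReal.ofReal (θ ^ 16) ≠ 0 := (ENNReal.ofReal_pos.2 (by positivity)).ne'
  have hmeas : AEMeasurable (fun x : PhaseSpace (m + 1) => ENNReal.ofReal (x.1 j ^ (2 * 16))) μ :=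
    (((measurable_pi_apply j).comp measurable_fst).pow_const _).ennreal_ofReal.aemeasurable
  calc μ {x | θ < x.1 j ^ 2} ≤ μ {x | ENNReal.ofReal (θ ^ 16) ≤ ENNReal.ofReal (x.1 j ^ (2 * 16))} := measure_mono hsub
    _ ≤ (∫⁻ x, ENNReal.ofReal (x.1 j ^ (2 * 16)) ∂μ) / ENNReal.ofReal (θ ^ 16) :=
        meas_ge_le_lintegral_div hmeas hθ16 ENNReal.ofReal_ne_top
    _ ≤ ENNReal.ofReal C / ENNReal.ofReal (θ ^ 16) := by
        refine ENNReal.div_le_div_right ?_ _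
        rw [← ofReal_integral_eq_lintegral_ofReal hint (ae_of_all _ fun x => (even_two_mul _).pow_nonneg _)]
        exact ENNReal.ofReal_le_ofReal hle
    _ = ENNReal.ofReal (C / θ ^ 16) := by rw [ENNReal.ofReal_div_of_pos (by positivity)]

include hω hl hβ hγ in
/-- **Tonelli + stationarity + the Gaussian moment of order `2k`**:
`∫ (∫_{(0,t]} p_i(Φ_r(x,Bω))^{2k} dr) d(μ_T ⊗ W) = (T^k ∏_{j<k}(2j+1)) · t⁺`. [folklore] -/
theorem lintegral_timeIntegral_momentum_pow {N : ℕ} (hN : 0 < N) (hT : 0 < T) (t : ℝ) (i : Fin N) (k : ℕ) :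
    ∫⁻ q, (∫⁻ r in Ioc 0 t, ENNReal.ofReal (((pinnedChain ω₂ lam β γ).solMap N T T r q.1 (pairPath q.2)).2 i ^ (2 * k)))
        ∂(((pinnedChain ω₂ lam β γ).gibbsMeasure N T).prod wienerPair) =
      ENNReal.ofReal (T ^ k * ∏ j ∈ Finset.range k, (2 * (j : ℝ) + 1)) * ENNReal.ofReal t := by
  -- adapted from `NonBallistic.pinnedChain_lintegral_timeIntegral_momentum_pow_eight`
  haveI : IsProbabilityMeasure ((pinnedChain ω₂ lam β γ).gibbsMeasure N T) :=
    pinnedChain_isProbabilityMeasure_gibbsMeasure hω hl hβ γ N hT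
  have hf : Measurable fun qr : (PhaseSpace N × WienerPair) × ℝ =>
      ENNReal.ofReal (((pinnedChain ω₂ lam β γ).solMap N T T qr.2 qr.1.1 (pairPath qr.1.2)).2 i ^ (2 * k)) := by
    have h1 := pinnedChain_measurable_solMap_pairPath_uncurry_swap hω hl hβ hγ N T T
    exact (((measurable_pi_apply i).comp (measurable_snd.comp h1)).pow_const _).ennreal_ofReal
  rw [lintegral_lintegral_swap hf.aemeasurable]
  have hstat : ∀ r : ℝ, (∫⁻ q,
      ENNReal.ofReal (((pinnedChain ω₂ lam β γ).solMap N T T r q.1 (pairPath q.2)).2 i ^ (2 * k))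
        ∂(((pinnedChain ω₂ lam β γ).gibbsMeasure N T).prod wienerPair)) =
      ENNReal.ofReal (T ^ k * ∏ j ∈ Finset.range k, (2 * (j : ℝ) + 1)) := by
    intro r
    rw [pinnedChain_lintegral_prod_solMap_gibbs hω hl hβ hγ N hN hT r
      (g := fun y : PhaseSpace N => ENNReal.ofReal (y.2 i ^ (2 * k))) (by fun_prop)]
    obtain ⟨hint, hval⟩ := commonPastBound_gibbsEvenMoments ω₂ lam β γ hω hl hβ T hT N i k
    rw [← ofReal_integral_eq_lintegral_ofReal hint (ae_of_all _ fun y => (even_two_mul _).pow_nonneg _), hval]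
  rw [lintegral_congr hstat, setLIntegral_const, Real.volume_Ioc, sub_zero]

include hω hl hβ hγ in
/-- **Time-integrated momentum tail, `N`-uniform**: for `t ≥ 0`, `a > 0` and every site `i`,
`(μ_T ⊗ W){a < ∫₀ᵗ p_i(Φ_r)² dr} ≤ C t^{16}/a^{16}` with `C = T^{16} ∏_{j<16}(2j+1)` (Markov with the sixteenth
power, Jensen in time, Tonelli, stationarity, Gaussian momenta). [folklore] -/
theorem timeIntegral_tail {N : ℕ} (hN : 0 < N) (hT : 0 < T) {t a : ℝ} (ht : 0 ≤ t) (ha : 0 < a) (i : Fin N) :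
    (((pinnedChain ω₂ lam β γ).gibbsMeasure N T).prod wienerPair)
        {q | a < ∫ r in (0:ℝ)..t, ((pinnedChain ω₂ lam β γ).solMap N T T r q.1 (pairPath q.2)).2 i ^ 2} ≤
      ENNReal.ofReal ((T ^ 16 * ∏ j ∈ Finset.range 16, (2 * (j : ℝ) + 1)) * t ^ 16 / a ^ 16) := by
  -- adapted from `NonBallistic.pinnedChain_probSite_timeIntegral_momentum_sq_gt` (fourth power there)
  haveI : IsProbabilityMeasure ((pinnedChain ω₂ lam β γ).gibbsMeasure N T) :=
    pinnedChain_isProbabilityMeasure_gibbsMeasure hω hl hβ γ N hT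
  set M : ℝ := T ^ 16 * ∏ j ∈ Finset.range 16, (2 * (j : ℝ) + 1) with hM
  have hM0 : 0 ≤ M := by
    rw [hM]; exact mul_nonneg (pow_nonneg hT.le _) (Finset.prod_nonneg fun j _ => by positivity)
  set π := ((pinnedChain ω₂ lam β γ).gibbsMeasure N T).prod wienerPair with hπ
  set p : ℝ → PhaseSpace N × WienerPair → ℝ := fun r q =>
    ((pinnedChain ω₂ lam β γ).solMap N T T r q.1 (pairPath q.2)).2 i with hp
  have hpc : ∀ q, Continuous fun r => p r q := fun q =>
    (continuous_apply i).comp (continuous_snd.comp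
      (pinnedChain_continuous_solMap hω hl hβ hγ N T T q.1 (pairPath q.2)))
  have hpm : ∀ k : ℕ, Measurable fun qr : (PhaseSpace N × WienerPair) × ℝ => ENNReal.ofReal (p qr.2 qr.1 ^ k) := by
    intro k
    have h1 := pinnedChain_measurable_solMap_pairPath_uncurry_swap hω hl hβ hγ N T T
    exact (((measurable_pi_apply i).comp (measurable_snd.comp h1)).pow_const k).ennreal_ofReal
  set Xl : PhaseSpace N × WienerPair → ℝ≥0∞ := fun q => ∫⁻ r in Ioc 0 t, ENNReal.ofReal (p r q ^ 2) with hXl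
  set Yl : PhaseSpace N × WienerPair → ℝ≥0∞ := fun q => ∫⁻ r in Ioc 0 t, ENNReal.ofReal (p r q ^ 32) with hYl
  have hXlm : Measurable Xl := (hpm 2).lintegral_prod_right'
  have hofReal : ∀ {k : ℕ}, Even k → ∀ q : PhaseSpace N × WienerPair,
      ENNReal.ofReal (∫ r in (0:ℝ)..t, p r q ^ k) = ∫⁻ r in Ioc 0 t, ENNReal.ofReal (p r q ^ k) := by
    intro k hk q
    rw [intervalIntegral.integral_of_le ht]
    exact ofReal_integral_eq_lintegral_ofReal ((hpc q).pow k).integrableOn_Ioc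
      (ae_of_all _ fun r => hk.pow_nonneg _)
  -- pointwise Jensen in time: `X^16 ≤ t^15 Y`
  have hJ : ∀ q, Xl q ^ 16 ≤ ENNReal.ofReal (t ^ 15) * Yl q := by
    intro q
    have hX0 : 0 ≤ ∫ r in (0:ℝ)..t, p r q ^ 2 := intervalIntegral.integral_nonneg ht fun r _ => sq_nonneg _
    have h1 := lightCone_pow_intervalIntegral_le (f := fun r => p r q ^ 2) ((hpc q).pow 2) (fun r => sq_nonneg _) ht 4
    have e32 : ∀ r, (p r q ^ 2) ^ (2 ^ 4) = p r q ^ 32 := fun r => by rw [← pow_mul]; norm_num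
    simp only [e32] at h1
    norm_num at h1
    calc Xl q ^ 16 = ENNReal.ofReal ((∫ r in (0:ℝ)..t, p r q ^ 2) ^ 16) := by
          rw [ENNReal.ofReal_pow hX0, hofReal even_two q]
      _ ≤ ENNReal.ofReal (t ^ 15 * ∫ r in (0:ℝ)..t, p r q ^ 32) := ENNReal.ofReal_le_ofReal h1
      _ = ENNReal.ofReal (t ^ 15) * Yl q := by
          rw [ENNReal.ofReal_mul (pow_nonneg ht 15), hofReal (by decide) q]
  have hsub : {q : PhaseSpace N × WienerPair | a < ∫ r in (0:ℝ)..t, p r q ^ 2} ⊆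
      {q | ENNReal.ofReal a ^ 16 ≤ Xl q ^ 16} := by
    intro q hq
    simp only [Set.mem_setOf_eq] at hq ⊢
    have h : ENNReal.ofReal a ≤ Xl q := by
      show ENNReal.ofReal a ≤ ∫⁻ r in Ioc 0 t, ENNReal.ofReal (p r q ^ 2)
      rw [← hofReal even_two q]
      exact ENNReal.ofReal_le_ofReal hq.le
    gcongr
  have ha16 : ENNReal.ofReal a ^ 16 ≠ 0 := pow_ne_zero _ (ENNReal.ofReal_pos.2 ha).ne'
  have ha16' : ENNReal.ofReal a ^ 16 ≠ ∞ := ENNReal.pow_ne_top ENNReal.ofReal_ne_top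
  have hYI : ∫⁻ q, Yl q ∂π = ENNReal.ofReal M * ENNReal.ofReal t := by
    have := lintegral_timeIntegral_momentum_pow hω hl hβ hγ hN hT t i 16
    simpa only [hYl, hp, hM] using this
  calc π {q | a < ∫ r in (0:ℝ)..t, p r q ^ 2}
      ≤ π {q | ENNReal.ofReal a ^ 16 ≤ Xl q ^ 16} := measure_mono hsub
    _ ≤ (∫⁻ q, Xl q ^ 16 ∂π) / ENNReal.ofReal a ^ 16 :=
        meas_ge_le_lintegral_div (hXlm.pow_const 16).aemeasurable ha16 ha16'
    _ ≤ (∫⁻ q, ENNReal.ofReal (t ^ 15) * Yl q ∂π) / ENNReal.ofReal a ^ 16 :=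
        ENNReal.div_le_div_right (lintegral_mono fun q => hJ q) _
    _ = ENNReal.ofReal (t ^ 15) * (ENNReal.ofReal M * ENNReal.ofReal t) / ENNReal.ofReal a ^ 16 := by
        rw [lintegral_const_mul' _ _ ENNReal.ofReal_ne_top, hYI]
    _ = ENNReal.ofReal (M * t ^ 16 / a ^ 16) := by
        rw [show M * t ^ 16 / a ^ 16 = t ^ 15 * (M * t) / a ^ 16 by ring,
          ENNReal.ofReal_div_of_pos (pow_pos ha 16), ENNReal.ofReal_mul (pow_nonneg ht 15),
          ENNReal.ofReal_mul hM0, ENNReal.ofReal_pow ha.le]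

end Tails

end BoxTail

open BoxTail in
/-- **Registered helper `pinnedChain_stationary_site_tails`** (probabilistic input of stub (C′)
`stub_uniformAnchoredCorrelationTails`, line `series-law-at-every-laplace-frequency`): under the stationary law
`μ_T ⊗ W` of the constructed Langevin flow of the pinned anharmonic chain with both baths at temperature `T > 0`
(Gibbs start, independent Brownian pair) there is ONE constant `C = C(ω₂, lam, β, T)`, independent of the length
`N` and of the site `j`, with `P{θ < q_j(0)²} ≤ C/θ^{16}` and `P{θ < ∫₀ᵗ p_j(Φ_r)² dr} ≤ C t^{16}/θ^{16}` for all
`t ≥ 0`, `θ > 0` (Markov with the sixteenth power; `N`-uniform Gibbs moments of order 32 of positions and momenta,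
Jensen in time, Tonelli, stationarity). [folklore] -/
theorem pinnedChain_stationary_site_tails :
    ∀ ω₂ lam β γ : ℝ, 0 < ω₂ → 0 ≤ lam → 0 ≤ β → 0 ≤ γ → ∀ T : ℝ, 0 < T →
      ∃ C : ℝ, 0 ≤ C ∧ ∀ (N : ℕ) (j : Fin N) (t θ : ℝ), 0 ≤ t → 0 < θ →
        (((Literature.MathematicalPhysics.KineticTheory.HeatConduction.pinnedChain ω₂ lam β γ).gibbsMeasure N T).prod
            Literature.Probability.Process.wienerPair)
            {q : Literature.MathematicalPhysics.KineticTheory.HeatConduction.PhaseSpace N ×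
                Literature.Probability.Process.WienerPair | θ < q.1.1 j ^ 2} ≤ ENNReal.ofReal (C / θ ^ 16) ∧
        (((Literature.MathematicalPhysics.KineticTheory.HeatConduction.pinnedChain ω₂ lam β γ).gibbsMeasure N T).prod
            Literature.Probability.Process.wienerPair)
            {q : Literature.MathematicalPhysics.KineticTheory.HeatConduction.PhaseSpace N ×
                Literature.Probability.Process.WienerPair |
              θ < ∫ r in (0:ℝ)..t,
                ((Literature.MathematicalPhysics.KineticTheory.HeatConduction.pinnedChain ω₂ lam β γ).solMap N T T r
                    q.1 (Literature.Probability.Process.pairPath q.2)).2 j ^ 2} ≤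
          ENNReal.ofReal (C * t ^ 16 / θ ^ 16) := by
  intro ω₂ lam β γ hω hl hβ hγ T hT
  obtain ⟨Cq, hCq0, hCq⟩ := position_tail (γ := γ) hω hl hβ hT
  set Cp : ℝ := T ^ 16 * ∏ j ∈ Finset.range 16, (2 * (j : ℝ) + 1) with hCp
  have hCp0 : 0 ≤ Cp := by
    rw [hCp]; exact mul_nonneg (pow_nonneg hT.le _) (Finset.prod_nonneg fun j _ => by positivity)
  refine ⟨max Cq Cp, le_trans hCq0 (le_max_left _ _), fun N j t θ ht hθ => ⟨?_, ?_⟩⟩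
  · refine (hCq N j θ hθ).trans (ENNReal.ofReal_le_ofReal ?_)
    exact div_le_div_of_nonneg_right (le_max_left _ _) (by positivity)
  · have hN : 0 < N := j.pos
    refine (timeIntegral_tail hω hl hβ hγ hN hT ht hθ j).trans (ENNReal.ofReal_le_ofReal ?_)
    rw [← hCp]
    exact div_le_div_of_nonneg_right (mul_le_mul_of_nonneg_right (le_max_right _ _) (by positivity)) (by positivity)

end Summit.AtomisticToContinuum.FouriersLaw.Theorems.AbelThermodynamicLimit.SeriesLawAtEveryLaplaceFrequency

end
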